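import Summits.QuantumAdvantage.QuantumAdvantage.Theorems.CharDialFrobPlane
import Mathlib.Algebra.MvPolynomial.Monad
import HarnessLib

/-!
# FrobSpace — Boolean functions on `𝔽_pᵏ` of total degree `≤ p − 1` are functions of ONE linear form (all `k`)

(decomp-qadv-lens-6 g8.)  `FrobPlane.frobSpace`: if `G : 𝔽_pᵏ → Bool` agrees with a polynomial of total degree
`≤ p − 1`, then `G x = h (Σ βᵢ xᵢ)` for some `β : 𝔽_pᵏ`, `h : 𝔽_p → Bool`.  This is the algebraic half of the CharDial
node's `FrobStructureLaw` (the census "sector `(p, k)`" statement for every `k`): several linear forms never mix.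

Proof: induction on `k`; `k ≤ 1` trivial, `k = 2` is `frobPlane`.  Step `k → k + 1` (`k ≥ 2`), by TRANSLATION
PROPAGATION: every slice `x_last = c` is `h_c(β_c · x')` by induction; if all slices are constant, `G = g(x_last)`;
otherwise some slice `c₀` is invariant under a translation `v ≠ 0` (`β_{c₀} · v = 0`, which exists as `k ≥ 2`).  For
any point `x₀` the plane `x₀ + s·(v,0) + t·e_last` carries a Boolean function of degree `≤ p − 1` in `(s,t)`, so by
`frobPlane` it is `h₂(a s + b t)`; its line at height `c₀` is constant in `s`, forcing `G(x₀ + (v,0)) = G(x₀)`.  Hence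
`G` is invariant under the translation `w = (v,0)` globally, factors through the quotient by `⟨w⟩ ≅ 𝔽_pᵏ` (again of
degree `≤ p − 1`), and the induction hypothesis finishes.  Substitutions by polynomials of degree `≤ 1` do not raise
the total degree (`totalDegree_bind₁_le_of_le_one`).
-/

namespace Summit.QuantumAdvantage.AdviceFreeQNC0

namespace FrobPlane

open MvPolynomial Finset

/-! ### Substitution by polynomials of degree ≤ 1 -/

section Subst

variable {σ τ R : Type*} [CommSemiring R]

/-- CharDial sub-characteristic helper `totalDegree_bind` (lens-6 g8 LAND package; see the module docstring). -/
theorem totalDegree_bind₁_le_of_le_one (f : σ → MvPolynomial τ R) (hf : ∀ i, (f i).totalDegree ≤ 1)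
    (P : MvPolynomial σ R) : (bind₁ f P).totalDegree ≤ P.totalDegree := by
  classical
  conv_lhs => rw [P.as_sum]
  rw [map_sum]
  refine (totalDegree_finsetSum _ _).trans (Finset.sup_le fun s hs => ?_)
  rw [bind₁_monomial]
  refine (totalDegree_mul _ _).trans ?_
  rw [totalDegree_C, zero_add]
  refine (totalDegree_finsetProd _ _).trans ?_
  refine le_trans (Finset.sum_le_sum fun i _ => (totalDegree_pow _ _).trans (Nat.mul_le_mul_left _ (hf i))) ?_
  simp only [mul_one]
  exact le_totalDegree hs

/-- CharDial sub-characteristic helper `eval_bind` (lens-6 g8 LAND package; see the module docstring). -/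
theorem eval_bind₁ (x : τ → R) (f : σ → MvPolynomial τ R) (P : MvPolynomial σ R) :
    eval x (bind₁ f P) = eval (fun i => eval x (f i)) P :=
  eval₂Hom_bind₁ _ _ _ _

end Subst

variable {p : ℕ} [hp : Fact p.Prime]

/-! ### Small dimensions -/

/-- CharDial sub-characteristic helper `frobSpace_zero` (lens-6 g8 LAND package; see the module docstring). -/
theorem frobSpace_zero (G : (Fin 0 → ZMod p) → Bool) :
    ∃ (β : Fin 0 → ZMod p) (h : ZMod p → Bool), ∀ x, G x = h (∑ i, β i * x i) :=
  ⟨Fin.elim0, fun _ => G Fin.elim0, fun x => by rw [Subsingleton.elim x Fin.elim0]⟩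

/-- CharDial sub-characteristic helper `frobSpace_one` (lens-6 g8 LAND package; see the module docstring). -/
theorem frobSpace_one (G : (Fin 1 → ZMod p) → Bool) :
    ∃ (β : Fin 1 → ZMod p) (h : ZMod p → Bool), ∀ x, G x = h (∑ i, β i * x i) := by
  refine ⟨fun _ => 1, fun s => G (fun _ => s), fun x => ?_⟩
  rw [Fin.sum_univ_one, one_mul]
  congr 1; funext i; rw [Subsingleton.elim i 0]

/-- CharDial sub-characteristic helper `frobSpace_two` (lens-6 g8 LAND package; see the module docstring). -/
theorem frobSpace_two (G : (Fin 2 → ZMod p) → Bool) (P : MvPolynomial (Fin 2) (ZMod p))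
    (hdeg : P.totalDegree ≤ p - 1) (hP : ∀ x, eval x P = if G x then 1 else 0) :
    ∃ (β : Fin 2 → ZMod p) (h : ZMod p → Bool), ∀ x, G x = h (∑ i, β i * x i) := by
  obtain ⟨a, b, h, hh⟩ := frobPlane p G P hdeg hP
  exact ⟨![a, b], h, fun x => by rw [hh x, Fin.sum_univ_two]; rfl⟩

/-! ### The induction step `k → k + 1` for `k ≥ 2` -/

section Step

variable {k : ℕ}

/-- Substitution for the slice `x_last = c`. -/
noncomputable def sliceSub (c : ZMod p) : Fin (k + 1) → MvPolynomial (Fin k) (ZMod p) :=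
  Fin.snoc (fun j => X j) (C c)

/-- CharDial sub-characteristic helper `sliceSub_deg` (lens-6 g8 LAND package; see the module docstring). -/
theorem sliceSub_deg (c : ZMod p) (i : Fin (k + 1)) : (sliceSub (k := k) c i).totalDegree ≤ 1 := by
  obtain ⟨j, rfl⟩ | rfl := Fin.eq_castSucc_or_eq_last i
  · simp [sliceSub, totalDegree_X]
  · simp [sliceSub, totalDegree_C]

/-- CharDial sub-characteristic helper `eval_sliceSub` (lens-6 g8 LAND package; see the module docstring). -/
theorem eval_sliceSub (c : ZMod p) (x' : Fin k → ZMod p) :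
    (fun i => eval x' (sliceSub c i)) = Fin.snoc x' c := by
  funext i
  obtain ⟨j, rfl⟩ | rfl := Fin.eq_castSucc_or_eq_last i
  · simp [sliceSub]
  · simp [sliceSub]

/-- Substitution for the plane `x₀ + s·w + t·e`. -/
noncomputable def planeSub (x₀ w e : Fin (k + 1) → ZMod p) : Fin (k + 1) → MvPolynomial (Fin 2) (ZMod p) :=
  fun i => C (x₀ i) + C (w i) * X 0 + C (e i) * X 1

/-- CharDial sub-characteristic helper `planeSub_deg` (lens-6 g8 LAND package; see the module docstring). -/
theorem planeSub_deg (x₀ w e : Fin (k + 1) → ZMod p) (i : Fin (k + 1)) : (planeSub x₀ w e i).totalDegree ≤ 1 := by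
  unfold planeSub
  refine (totalDegree_add _ _).trans (max_le ((totalDegree_add _ _).trans (max_le ?_ ?_)) ?_)
  · simp [totalDegree_C]
  · refine (totalDegree_mul _ _).trans ?_; simp [totalDegree_C, totalDegree_X]
  · refine (totalDegree_mul _ _).trans ?_; simp [totalDegree_C, totalDegree_X]

/-- CharDial sub-characteristic helper `eval_planeSub` (lens-6 g8 LAND package; see the module docstring). -/
theorem eval_planeSub (x₀ w e : Fin (k + 1) → ZMod p) (y : Fin 2 → ZMod p) :
    (fun i => eval y (planeSub x₀ w e i)) = x₀ + y 0 • w + y 1 • e := by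
  funext i
  simp [planeSub, mul_comm]

/-- Substitution for the quotient by the `j'`-th coordinate direction: insert `0` at `j'`. -/
noncomputable def quotSub (j' : Fin (k + 1)) : Fin (k + 1) → MvPolynomial (Fin k) (ZMod p) :=
  Fin.insertNth j' 0 (fun m => X m)

/-- CharDial sub-characteristic helper `quotSub_deg` (lens-6 g8 LAND package; see the module docstring). -/
theorem quotSub_deg (j' i : Fin (k + 1)) : (quotSub (p := p) (k := k) j' i).totalDegree ≤ 1 := by
  rcases Fin.eq_self_or_eq_succAbove j' i with rfl | ⟨m, rfl⟩
  · simp [quotSub]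
  · simp [quotSub, totalDegree_X]

/-- CharDial sub-characteristic helper `eval_quotSub` (lens-6 g8 LAND package; see the module docstring). -/
theorem eval_quotSub (j' : Fin (k + 1)) (y : Fin k → ZMod p) :
    (fun i => eval y (quotSub j' i)) = Fin.insertNth j' (0 : ZMod p) y := by
  funext i
  rcases Fin.eq_self_or_eq_succAbove j' i with rfl | ⟨m, rfl⟩
  · simp [quotSub]
  · simp [quotSub]

/-- **Induction step.** -/
theorem frobSpace_step (hk : 2 ≤ k)
    (ih : ∀ (G : (Fin k → ZMod p) → Bool) (P : MvPolynomial (Fin k) (ZMod p)),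
      P.totalDegree ≤ p - 1 → (∀ x, eval x P = if G x then 1 else 0) →
      ∃ (β : Fin k → ZMod p) (h : ZMod p → Bool), ∀ x, G x = h (∑ i, β i * x i))
    (G : (Fin (k + 1) → ZMod p) → Bool) (P : MvPolynomial (Fin (k + 1)) (ZMod p))
    (hdeg : P.totalDegree ≤ p - 1) (hP : ∀ x, eval x P = if G x then 1 else 0) :
    ∃ (β : Fin (k + 1) → ZMod p) (h : ZMod p → Bool), ∀ x, G x = h (∑ i, β i * x i) := by
  classical
  -- slices
  have hslice : ∀ c : ZMod p, ∃ (β : Fin k → ZMod p) (h : ZMod p → Bool),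
      ∀ x', G (Fin.snoc x' c) = h (∑ i, β i * x' i) := by
    intro c
    refine ih (fun x' => G (Fin.snoc x' c)) (bind₁ (sliceSub c) P)
      ((totalDegree_bind₁_le_of_le_one _ (sliceSub_deg c) P).trans hdeg) fun x' => ?_
    rw [eval_bind₁, eval_sliceSub, hP]
  choose βs hs hβs using hslice
  by_cases hconst : ∀ c (x' y' : Fin k → ZMod p), G (Fin.snoc x' c) = G (Fin.snoc y' c)
  · -- all slices constant: G = g(x_last)
    refine ⟨fun i => if i = Fin.last k then 1 else 0, fun s => G (Fin.snoc 0 s), fun x => ?_⟩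
    have hsum : (∑ i, (if i = Fin.last k then (1 : ZMod p) else 0) * x i) = x (Fin.last k) := by
      rw [Fin.sum_univ_castSucc]
      simp [ne_of_lt (Fin.castSucc_lt_last _)]
    rw [hsum]
    conv_lhs => rw [← Fin.snoc_init_self x]
    exact hconst _ _ _
  · push Not at hconst
    obtain ⟨c₀, x₁, y₁, hne⟩ := hconst
    -- the direction β := βs c₀ is nonzero
    set β := βs c₀ with hβdef
    have hβ : ∃ i, β i ≠ 0 := by
      by_contra h0
      push Not at h0
      apply hne
      rw [hβs c₀ x₁, hβs c₀ y₁]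
      simp [← hβdef, h0]
    obtain ⟨i, hi⟩ := hβ
    -- a second index
    have hjj : ∃ jj : Fin k, jj ≠ i := by
      by_cases h0 : i = ⟨0, by omega⟩
      · exact ⟨⟨1, by omega⟩, by rw [h0]; simp [Fin.ext_iff]⟩
      · exact ⟨⟨0, by omega⟩, fun h => h0 h.symm⟩
    obtain ⟨jj, hji⟩ := hjj
    -- the kernel vector v
    let v : Fin k → ZMod p := fun m => if m = jj then β i else if m = i then -β jj else 0
    have hvjj : v jj = β i := by simp [v]
    have hβv : ∑ m, β m * v m = 0 := by
      have hterm : ∀ m, β m * v m = (if m = jj then β jj * β i else 0) + (if m = i then -(β i * β jj) else 0) := by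
        intro m
        by_cases h1 : m = jj
        · subst h1; simp [v, hji]
        · by_cases h2 : m = i
          · subst h2; simp [v, h1]
          · simp [v, h1, h2]
      rw [Finset.sum_congr rfl fun m _ => hterm m, Finset.sum_add_distrib, Finset.sum_ite_eq', Finset.sum_ite_eq']
      simp; ring
    -- slice invariance under v
    have hinv0 : ∀ (x' : Fin k → ZMod p) (s : ZMod p), G (Fin.snoc (x' + s • v) c₀) = G (Fin.snoc x' c₀) := by
      intro x' s
      rw [hβs c₀, hβs c₀]
      congr 1
      simp only [Pi.add_apply, Pi.smul_apply, smul_eq_mul, mul_add, Finset.sum_add_distrib]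
      have : ∑ m, β m * (s * v m) = s * ∑ m, β m * v m := by
        rw [Finset.mul_sum]; exact Finset.sum_congr rfl fun m _ => by ring
      rw [← hβdef, this, hβv, mul_zero, add_zero]
    -- the global translation w = (v, 0) and the vertical unit e
    let w : Fin (k + 1) → ZMod p := Fin.snoc v 0
    let e : Fin (k + 1) → ZMod p := Fin.snoc 0 1
    have hw_last : w (Fin.last k) = 0 := by simp [w]
    have hw_cs : ∀ m : Fin k, w m.castSucc = v m := by intro m; simp [w]
    have he_last : e (Fin.last k) = 1 := by simp [e]
    have he_cs : ∀ m : Fin k, e m.castSucc = 0 := by intro m; simp [e]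
    -- global invariance under w
    have hinv1 : ∀ x₀ : Fin (k + 1) → ZMod p, G (x₀ + w) = G x₀ := by
      intro x₀
      let Gp : (Fin 2 → ZMod p) → Bool := fun y => G (x₀ + y 0 • w + y 1 • e)
      obtain ⟨a, b, h₂, hh₂⟩ := frobPlane p Gp (bind₁ (planeSub x₀ w e) P)
        ((totalDegree_bind₁_le_of_le_one _ (planeSub_deg x₀ w e) P).trans hdeg)
        (fun y => by rw [eval_bind₁, eval_planeSub, hP])
      -- the line at height c₀ is constant in s
      let t₀ : ZMod p := c₀ - x₀ (Fin.last k)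
      have hline : ∀ s : ZMod p, x₀ + s • w + t₀ • e = Fin.snoc (Fin.init x₀ + s • v) c₀ := by
        intro s
        funext idx
        obtain ⟨m, rfl⟩ | rfl := Fin.eq_castSucc_or_eq_last idx
        · simp [hw_cs, he_cs, Fin.init]
        · simp [hw_last, he_last, t₀]
      have hconst_s : ∀ s : ZMod p, h₂ (a * s + b * t₀) = h₂ (a * 0 + b * t₀) := by
        intro s
        have h1 := hh₂ ![s, t₀]
        have h0 := hh₂ ![0, t₀]
        simp only [Gp, Matrix.cons_val_zero, Matrix.cons_val_one] at h1 h0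
        rw [← h1, ← h0, hline s, hline 0, hinv0, zero_smul, add_zero]
      have hG1 : G (x₀ + w) = h₂ (a * 1 + b * 0) := by
        have := hh₂ ![1, 0]
        simp only [Gp, Matrix.cons_val_zero, Matrix.cons_val_one, one_smul, zero_smul, add_zero] at this
        exact this
      have hG0 : G x₀ = h₂ (a * 0 + b * 0) := by
        have := hh₂ ![0, 0]
        simp only [Gp, Matrix.cons_val_zero, Matrix.cons_val_one, zero_smul, add_zero] at this
        exact this
      rw [hG1, hG0]
      by_cases ha : a = 0
      · simp [ha]
      · have e1 := hconst_s ((a * 1 + b * 0 - b * t₀) * a⁻¹)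
        have e0 := hconst_s ((a * 0 + b * 0 - b * t₀) * a⁻¹)
        rw [show a * ((a * 1 + b * 0 - b * t₀) * a⁻¹) + b * t₀ = a * 1 + b * 0 by field_simp; ring] at e1
        rw [show a * ((a * 0 + b * 0 - b * t₀) * a⁻¹) + b * t₀ = a * 0 + b * 0 by field_simp; ring] at e0
        rw [e1, e0]
    have hinvN : ∀ (x₀ : Fin (k + 1) → ZMod p) (m : ℕ), G (x₀ + (m : ZMod p) • w) = G x₀ := by
      intro x₀ m
      induction m with
      | zero => simp
      | succ m ihm => rw [Nat.cast_succ, add_smul, one_smul, ← add_assoc, hinv1, ihm]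
    have hinv : ∀ (x₀ : Fin (k + 1) → ZMod p) (c : ZMod p), G (x₀ + c • w) = G x₀ := by
      intro x₀ c
      rw [← ZMod.natCast_zmod_val c]
      exact hinvN x₀ c.val
    -- quotient by ⟨w⟩: eliminate the coordinate j' = jj.castSucc (w j' = β i ≠ 0)
    let j' : Fin (k + 1) := jj.castSucc
    have hwj : w j' ≠ 0 := by rw [hw_cs, hvjj]; exact hi
    let Gq : (Fin k → ZMod p) → Bool := fun y => G (Fin.insertNth j' (0 : ZMod p) y)
    obtain ⟨γ, h₃, hh₃⟩ := ih Gq (bind₁ (quotSub j') P)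
      ((totalDegree_bind₁_le_of_le_one _ (quotSub_deg j') P).trans hdeg)
      (fun y => by rw [eval_bind₁, eval_quotSub, hP])
    let S : ZMod p := ∑ m, γ m * w (j'.succAbove m)
    refine ⟨Fin.insertNth j' (-((w j')⁻¹ * S)) γ, h₃, fun x => ?_⟩
    -- move x into the hyperplane x_{j'} = 0 along w
    let c : ZMod p := x j' * (w j')⁻¹
    let z : Fin (k + 1) → ZMod p := x + (-c) • w
    have hz : z j' = 0 := by
      simp only [z, c, Pi.add_apply, Pi.smul_apply, smul_eq_mul]
      field_simp
      ring
    have hGz : G x = G z := (hinv x (-c)).symm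
    have hzq : Fin.insertNth j' (0 : ZMod p) (Fin.removeNth j' z) = z := by
      rw [← hz]; exact Fin.insertNth_self_removeNth j' z
    rw [hGz, ← hzq]
    show Gq (Fin.removeNth j' z) = _
    rw [hh₃]
    congr 1
    rw [Fin.sum_univ_succAbove _ j', Fin.insertNth_apply_same]
    simp only [Fin.removeNth_apply, Fin.insertNth_apply_succAbove, z, c, Pi.add_apply, Pi.smul_apply, smul_eq_mul]
    have : ∑ m, γ m * (x (j'.succAbove m) + -(x j' * (w j')⁻¹) * w (j'.succAbove m))
        = ∑ m, γ m * x (j'.succAbove m) + -(x j' * (w j')⁻¹) * S := by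
      simp only [S, Finset.mul_sum, mul_add, Finset.sum_add_distrib]
      congr 1
      exact Finset.sum_congr rfl fun m _ => by ring
    rw [this]
    ring

end Step

/-- **Boolean functions on `𝔽_pᵏ` of total degree `≤ p − 1` are functions of one linear form.** -/
theorem frobSpace (p : ℕ) [Fact p.Prime] : ∀ (k : ℕ) (G : (Fin k → ZMod p) → Bool)
    (P : MvPolynomial (Fin k) (ZMod p)), P.totalDegree ≤ p - 1 → (∀ x, eval x P = if G x then 1 else 0) →
    ∃ (β : Fin k → ZMod p) (h : ZMod p → Bool), ∀ x, G x = h (∑ i, β i * x i) := by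
  intro k
  induction k with
  | zero => intro G _ _ _; exact frobSpace_zero G
  | succ k ih =>
    intro G P hdeg hP
    rcases Nat.lt_or_ge k 2 with hk | hk
    · interval_cases k
      · exact frobSpace_one G
      · exact frobSpace_two G P hdeg hP
    · exact frobSpace_step hk ih G P hdeg hP

end FrobPlane

end Summit.QuantumAdvantage.AdviceFreeQNC0
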